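import Literature.NumberTheory.Automorphic.BrandtXi
import HarnessLib

/-!
# The Brandt matrix entries do not depend on the chosen representatives

Topic `NumberTheory/Automorphic`; theorems only, about the tree's `Brandt.matrix O n`
(`Literature/NumberTheory/Automorphic/BrandtXi.lean`, Voight (41.1.1)):
`T(n)_ij = #{J ⊆ I_j : [I_j : J] = n², J = α I_i for some α ∈ Dˣ}`, computed on the representatives
`I_i = i.rep`, `I_j = j.rep` chosen by `Quotient.out`. The docstring of `Brandt.matrix` asserts that the
count "does not depend on the representatives (`J ↦ β J`)"; this file proves it (companion of
`BrandtWeightClassFunction.lean`, which does the same for the weights):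

* `Brandt.units_smul_le_units_smul_iff`, `Brandt.relIndex_units_smul` : left translation by a unit
  `β` is an inclusion- and index-preserving bijection on `ℤ`-lattices (`[βI : βJ] = [I : J]`);
* `Brandt.brandtSet_smul_right` : replacing the ambient ideal `I` by `β I` replaces the counted set
  by its image under `J ↦ β J`; `Brandt.brandtSet_smul_left` : replacing the class representative
  `I'` by `γ I'` does not change the set at all; hence `Brandt.ncard_brandtSet_smul`;
* `Brandt.matrix_apply_eq_ncard` : **`T(n)_ij` may be computed on ANY representatives** `I' ∈ i`,
  `I ∈ j` (Voight §41.1; Pizer 1980 §2, Prop. 2.3).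

Valid for every ring `D` and every `ℤ`-submodule `O`; no arithmetic input.

## References

* J. Voight, *Quaternion Algebras*, GTM 288 (2021), §17.3, §41.1, (41.1.1) [Voight2021].
* A. Pizer, J. Algebra 64 (1980), §2 [Pizer1980].
-/

noncomputable section

open scoped Pointwise

universe u

namespace Literature.NumberTheory.Automorphic

namespace Brandt

variable {D : Type u} [Ring D]

/-! ### Translation by a unit preserves inclusions and indices -/

/-- `β J ≤ β I ↔ J ≤ I` for a unit `β`. [folklore] -/
theorem units_smul_le_units_smul_iff (β : Dˣ) {J I : Submodule ℤ D} : β • J ≤ β • I ↔ J ≤ I := by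
  constructor
  · intro h x hx
    have hx' : (β : D) * x ∈ β • J := by
      rw [mem_units_smul_submodule_iff, Units.smul_def, smul_eq_mul, ← mul_assoc, Units.inv_mul,
        one_mul]
      exact hx
    have := h hx'
    rwa [mem_units_smul_submodule_iff, Units.smul_def, smul_eq_mul, ← mul_assoc, Units.inv_mul,
      one_mul] at this
  · intro h x hx
    rw [mem_units_smul_submodule_iff] at hx ⊢
    exact h hx

/-- The translate `β J`, as an additive subgroup, is the image of `J` under the additive
automorphism `x ↦ β x`. [folklore] -/
theorem toAddSubgroup_units_smul (β : Dˣ) (J : Submodule ℤ D) :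
    (β • J).toAddSubgroup =
      J.toAddSubgroup.map ((DistribMulAction.toAddEquiv D β : D ≃+ D) : D →+ D) := by
  ext x
  simp only [Submodule.mem_toAddSubgroup, AddSubgroup.mem_map, AddMonoidHom.coe_coe,
    DistribMulAction.toAddEquiv_apply]
  rw [mem_units_smul_submodule_iff]
  constructor
  · intro hx
    exact ⟨_, hx, smul_inv_smul β x⟩
  · rintro ⟨y, hy, rfl⟩
    rwa [inv_smul_smul]

/-- **`[β I : β J] = [I : J]`**: translation by a unit preserves relative indices of
`ℤ`-lattices. [folklore] -/
theorem relIndex_units_smul (β : Dˣ) (J I : Submodule ℤ D) :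
    (β • J).toAddSubgroup.relIndex (β • I).toAddSubgroup =
      J.toAddSubgroup.relIndex I.toAddSubgroup := by
  rw [toAddSubgroup_units_smul, toAddSubgroup_units_smul]
  exact AddSubgroup.relIndex_map_map_of_injective _ _ (DistribMulAction.toAddEquiv D β).injective

/-! ### The counted sets under a change of representatives -/

/-- Changing the ambient representative `I ↦ β I` replaces the set counted by a Brandt entry by its
image under `J ↦ β J`. [folklore] -/
theorem brandtSet_smul_right (β : Dˣ) (n : ℕ) (I' I : Submodule ℤ D) :
    {J : Submodule ℤ D | J ≤ β • I ∧ J.toAddSubgroup.relIndex (β • I).toAddSubgroup = n ^ 2 ∧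
        ∃ α : Dˣ, J = α • I'} =
      (fun J : Submodule ℤ D => β • J) ''
        {J : Submodule ℤ D | J ≤ I ∧ J.toAddSubgroup.relIndex I.toAddSubgroup = n ^ 2 ∧
          ∃ α : Dˣ, J = α • I'} := by
  ext J
  simp only [Set.mem_setOf_eq, Set.mem_image]
  constructor
  · rintro ⟨hle, hidx, α, hα⟩
    refine ⟨β⁻¹ • J, ⟨?_, ?_, β⁻¹ * α, by rw [hα, mul_smul]⟩, smul_inv_smul β J⟩
    · rwa [← units_smul_le_units_smul_iff β, smul_inv_smul]
    · rw [← relIndex_units_smul β, smul_inv_smul]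
      exact hidx
  · rintro ⟨J₀, ⟨hle, hidx, α, hα⟩, rfl⟩
    refine ⟨(units_smul_le_units_smul_iff β).mpr hle, ?_, β * α, by rw [hα, mul_smul]⟩
    rw [relIndex_units_smul]
    exact hidx

/-- Changing the class representative `I' ↦ γ I'` does not change the set counted by a Brandt
entry (`α (γ I') = (α γ) I'`). [folklore] -/
theorem brandtSet_smul_left (γ : Dˣ) (n : ℕ) (I' I : Submodule ℤ D) :
    {J : Submodule ℤ D | J ≤ I ∧ J.toAddSubgroup.relIndex I.toAddSubgroup = n ^ 2 ∧
        ∃ α : Dˣ, J = α • (γ • I')} =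
      {J : Submodule ℤ D | J ≤ I ∧ J.toAddSubgroup.relIndex I.toAddSubgroup = n ^ 2 ∧
        ∃ α : Dˣ, J = α • I'} := by
  ext J
  simp only [Set.mem_setOf_eq]
  refine and_congr_right fun _ => and_congr_right fun _ => ⟨?_, ?_⟩
  · rintro ⟨α, hα⟩
    exact ⟨α * γ, by rw [hα, mul_smul]⟩
  · rintro ⟨α, hα⟩
    exact ⟨α * γ⁻¹, by rw [hα, mul_smul, inv_smul_smul]⟩

/-- The number of lattices counted by a Brandt entry is unchanged under `I ↦ β I`, `I' ↦ γ I'`.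
[folklore] -/
theorem ncard_brandtSet_smul (β γ : Dˣ) (n : ℕ) (I' I : Submodule ℤ D) :
    {J : Submodule ℤ D | J ≤ β • I ∧ J.toAddSubgroup.relIndex (β • I).toAddSubgroup = n ^ 2 ∧
        ∃ α : Dˣ, J = α • (γ • I')}.ncard =
      {J : Submodule ℤ D | J ≤ I ∧ J.toAddSubgroup.relIndex I.toAddSubgroup = n ^ 2 ∧
        ∃ α : Dˣ, J = α • I'}.ncard := by
  rw [brandtSet_smul_left, brandtSet_smul_right]
  exact Set.ncard_image_of_injective _ (MulAction.injective β)

/-! ### `T(n)_ij` on arbitrary representatives -/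

/-- Two right ideals in the same class differ by a unit: `⟦I⟧ = ⟦I'⟧ → ∃ β, I' = β I`. [folklore] -/
theorem exists_eq_smul_of_mk_eq_mk {O : Submodule ℤ D} {I I' : rightIdeals O}
    (h : (Quotient.mk (rightClassSetoid O) I : ClassSet O) = Quotient.mk (rightClassSetoid O) I') :
    ∃ β : Dˣ, (I' : Submodule ℤ D) = β • (I : Submodule ℤ D) := by
  obtain ⟨β, hβ⟩ := Quotient.exact h
  exact ⟨β, hβ⟩

/-- The chosen representative of the class of `I` is a unit translate of `I`. [folklore] -/
theorem exists_rep_mk_eq_smul {O : Submodule ℤ D} (I : rightIdeals O) :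
    ∃ β : Dˣ, ClassSet.rep (Quotient.mk (rightClassSetoid O) I : ClassSet O) =
      β • (I : Submodule ℤ D) := by
  set c : ClassSet O := Quotient.mk (rightClassSetoid O) I with hc
  have h : (Quotient.mk (rightClassSetoid O) I : ClassSet O) =
      Quotient.mk (rightClassSetoid O) ⟨c.rep, c.rep_mem⟩ := by
    rw [ClassSet.mk_rep, hc]
  exact exists_eq_smul_of_mk_eq_mk h

/-- **The Brandt matrix entry `T(n)_ij` may be computed on any representatives**: for right ideals
`I'` of class `i` and `I` of class `j`,
`T(n)_ij = #{J ⊆ I : [I : J] = n², J = α I' for some unit α}` (Voight 2021, §41.1; Pizer 1980, §2).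
[cite: Voight2021, (41.1.1)] -/
theorem matrix_apply_eq_ncard (O : Submodule ℤ D) (n : ℕ) (I' I : rightIdeals O) :
    matrix O n (Quotient.mk (rightClassSetoid O) I') (Quotient.mk (rightClassSetoid O) I) =
      ({J : Submodule ℤ D | J ≤ (I : Submodule ℤ D) ∧
          J.toAddSubgroup.relIndex (I : Submodule ℤ D).toAddSubgroup = n ^ 2 ∧
          ∃ α : Dˣ, J = α • (I' : Submodule ℤ D)}.ncard : ℤ) := by
  obtain ⟨β, hβ⟩ := exists_rep_mk_eq_smul I
  obtain ⟨γ, hγ⟩ := exists_rep_mk_eq_smul I'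
  rw [matrix, Matrix.of_apply, hβ, hγ, ncard_brandtSet_smul]

end Brandt

end Literature.NumberTheory.Automorphic

end
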